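import Summits.CriticalPhenomena.Ising3DConformalLimit.Theorems.PlantedPinningMoebiusLimitExistsRegularPolygonRotation
import Mathlib.Analysis.InnerProductSpace.Projection.Reflection
import HarnessLib

/-!
# Reflection symmetry of the unit regular horizontal `n`-gon

Stub N1c of line `Sketch` (skeleton v26) for crux `MoebiusLimitExists` (stmt-CriticalPhenomena-1344):
the second generator of the dihedral stabiliser of the unit regular horizontal `n`-gon
`P_n i = cos(2πi/n) e₁ + sin(2πi/n) e₂` in `ℝ³ = EuclideanSpace ℝ (Fin 3)`: a linear isometry `Z` fixing the
vertical vector `e₀ = EuclideanSpace.single 0 1` with `Z (P_n i) = P_n (Fin.rev i)` (`Fin.rev i = n − 1 − i`).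
It is the reflection in the plane `(ℝ ∙ e₂)ᗮ` (which fixes `e₀`, `e₁` and negates `e₂`, i.e. sends the angle
`θ` to `−θ`) followed by the axial rotation by `−2π/n` of
`MoebiusLimitExistsSketchV20.exists_axialRotation`; on angles `2πi/n ↦ −2πi/n − 2π/n = 2π(n−1−i)/n − 2π`.
-/

namespace Summit.CriticalPhenomena.Ising3DConformalLimit.MoebiusLimitExistsSketchV26

/-- The reflection of `ℝ³` in the plane `(ℝ ∙ e₂)ᗮ` fixes the vertical vector `e₀`
(`e₀ ⟂ e₂`, `Submodule.reflection_mem_subspace_eq_self`). [folklore] -/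
theorem reflection_orthogonal_e2_single_zero :
    (ℝ ∙ (EuclideanSpace.single 2 1 : EuclideanSpace ℝ (Fin 3)))ᗮ.reflection
        (EuclideanSpace.single 0 1 : EuclideanSpace ℝ (Fin 3)) = EuclideanSpace.single 0 1 := by
  apply Submodule.reflection_mem_subspace_eq_self
  rw [Submodule.mem_orthogonal_singleton_iff_inner_right, EuclideanSpace.inner_single_left]
  simp

/-- The reflection of `ℝ³` in the plane `(ℝ ∙ e₂)ᗮ` negates the `e₂`-component of a horizontal vector:
`cos θ • e₁ + sin θ • e₂ ↦ cos θ • e₁ − sin θ • e₂ = cos (−θ) • e₁ + sin (−θ) • e₂`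
(`Submodule.reflection_orthogonal_apply`, `Submodule.reflection_singleton_apply`). [folklore] -/
theorem reflection_orthogonal_e2_horizontal (θ : ℝ) :
    (ℝ ∙ (EuclideanSpace.single 2 1 : EuclideanSpace ℝ (Fin 3)))ᗮ.reflection
        (Real.cos θ • (EuclideanSpace.single 1 1 : EuclideanSpace ℝ (Fin 3)) +
          Real.sin θ • (EuclideanSpace.single 2 1 : EuclideanSpace ℝ (Fin 3))) =
      Real.cos (-θ) • (EuclideanSpace.single 1 1 : EuclideanSpace ℝ (Fin 3)) +
        Real.sin (-θ) • (EuclideanSpace.single 2 1 : EuclideanSpace ℝ (Fin 3)) := by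
  rw [Submodule.reflection_orthogonal_apply, Submodule.reflection_singleton_apply, Real.cos_neg,
    Real.sin_neg]
  ext j
  fin_cases j <;> simp [EuclideanSpace.inner_single_left]
  ring

/-- **STUB N1c `stub_regularPolygon_reflection` (M, pure geometry).**  There is a linear isometry `Z` of `ℝ³`
with `Z e₀ = e₀` and `Z (P_n i) = P_n (Fin.rev i)` for the unit regular horizontal `n`-gon
`P_n i = cos(2πi/n) e₁ + sin(2πi/n) e₂`: the reflection in the plane `(ℝ ∙ e₂)ᗮ` (angle `θ ↦ −θ`) followed by
the rotation by `−2π/n` about the `e₀`-axis, since `−2πi/n − 2π/n = 2π(n − 1 − i)/n − 2π` and `cos`, `sin`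
are `2π`-periodic (`Fin.val_rev`). [folklore] -/
theorem stub_regularPolygon_reflection : ∀ n : ℕ,
    ∃ Z : EuclideanSpace ℝ (Fin 3) ≃ₗᵢ[ℝ] EuclideanSpace ℝ (Fin 3),
      Z (EuclideanSpace.single 0 1) = EuclideanSpace.single 0 1 ∧
      ∀ i : Fin n,
        Z (Real.cos (2 * Real.pi * ((i : ℕ) : ℝ) / (n : ℝ)) • (EuclideanSpace.single 1 1 : EuclideanSpace ℝ (Fin 3)) +
            Real.sin (2 * Real.pi * ((i : ℕ) : ℝ) / (n : ℝ)) • (EuclideanSpace.single 2 1 : EuclideanSpace ℝ (Fin 3))) =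
          Real.cos (2 * Real.pi * (((Fin.rev i : Fin n) : ℕ) : ℝ) / (n : ℝ)) •
              (EuclideanSpace.single 1 1 : EuclideanSpace ℝ (Fin 3)) +
            Real.sin (2 * Real.pi * (((Fin.rev i : Fin n) : ℕ) : ℝ) / (n : ℝ)) •
              (EuclideanSpace.single 2 1 : EuclideanSpace ℝ (Fin 3)) := by
  intro n
  obtain ⟨R, hR0, hR⟩ := MoebiusLimitExistsSketchV20.exists_axialRotation (-(2 * Real.pi / (n : ℝ)))
  refine ⟨(ℝ ∙ (EuclideanSpace.single 2 1 : EuclideanSpace ℝ (Fin 3)))ᗮ.reflection.trans R, ?_, fun i => ?_⟩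
  · rw [LinearIsometryEquiv.trans_apply, reflection_orthogonal_e2_single_zero, hR0]
  · rw [LinearIsometryEquiv.trans_apply, reflection_orthogonal_e2_horizontal, hR]
    cases n with
    | zero => exact i.elim0
    | succ m =>
      -- the angle `−2πi/(m+1) − 2π/(m+1)` equals `2π(m − i)/(m+1) − 2π`, and `Fin.rev i = m − i`
      have h1 : -(2 * Real.pi * ((i : ℕ) : ℝ) / ((m + 1 : ℕ) : ℝ)) + -(2 * Real.pi / ((m + 1 : ℕ) : ℝ)) =
          2 * Real.pi * (((Fin.rev i : Fin (m + 1)) : ℕ) : ℝ) / ((m + 1 : ℕ) : ℝ) - 2 * Real.pi := by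
        have hN : ((m + 1 : ℕ) : ℝ) ≠ 0 := by positivity
        rw [Fin.val_rev, Nat.add_sub_add_right, Nat.cast_sub (Fin.is_le i)]
        field_simp
        push_cast
        ring
      rw [h1, Real.cos_sub_two_pi, Real.sin_sub_two_pi]

end Summit.CriticalPhenomena.Ising3DConformalLimit.MoebiusLimitExistsSketchV26
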